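import Summits.ResolutionOfSingularities.KangarooAtlas.MizutaniThetaRational
import HarnessLib

/-!
# Mizutani's step inequality `dim Diff_{i+1}(k)f ≥ dim Diff_i(k)f + 2` at tower level (Nagoya Math. J. 52 (1973), proof of Thm. 2.8)

Cell `pub-rosobs`, Mizutani enclosure (seat mizutani-encloser-2, gen 7). AI-written; AI review is weaker than expert
review; NOT a resolution-of-singularities theorem (summit relevance C).

Mizutani (p. 90): «We claim `dim_k Diff_{i+1}(k)f ≥ dim_k Diff_i(k)f + 2` (`i = 0, …, p − 2`)», proved by the cases (1) (some echelon
generator has coefficients generating an extension of degree `≥ p²`: two derivations give two new vectors), (2)(i) (different simple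
extensions `k^p(a_j)`: «`k^p(a_j) ∩ u·k^p(a_{j'})` has dimension `≤ 1`»), (2)(ii) (one simple extension `k^p(a)`: «`0 ≠ D^s(f) ∈ θ_1(f) ∩ W`,
a contradiction»).  This file proves the inequality for the tree's tower spans `Θ_m(v)` (`MizutaniExtremalProfile.lean`) of a vector `v`
with `L`-independent coordinates, ON THE POINT SIDE of Mizutani's duality `H ↔ H*` (as needed in Step (II) of Thm. 2.8), from three
hypotheses that the extremal configuration supplies (`MizutaniExtremalStep.lean`): (H) `Θ_{p−1}(v)` contains no nonzero `L`-rational vector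
(«`θ_1(f) ∩ W = {0}`»), (DUAL) every `w ⊥ Θ_{p−1}(v)` has `Θ_{p−1}(w) ⊥ v` (the flip symmetry of `J^p`), and `dim Θ_{p−1}(v) < #ι`:

* `IsRootTower.thetaSpan_zero_eq`, `finrank_thetaSpan_zero` (`Θ_0(v) = K·v`);
* **`IsRootTower.finrank_thetaSpan_add_two_le`** — `dim_K Θ_m(v) + 2 ≤ dim_K Θ_{m+1}(v)` for `m + 2 ≤ p`: with an echelon basis `g_j` of `Θ_m(v)`
  (`MizutaniThetaEchelon.lean`) the increment is `dim span{∂_l g_j}`; if it were `≤ 1`, all `∂_l g_j` are multiples of one vector `r`;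
  `r` rational contradicts (H); otherwise the mixed-derivative symmetry forces every coordinate of every `g_j` and of `r` to have differential
  parallel to `dα` (`α` a non-rational coordinate of `r`), hence to lie in `L(α)` (`MizutaniThetaStep.mem_adjoin_simple_of_der_eq_mul`); then
  `Θ_{p−1}(v)` is spanned by `L(α)`-vectors (`MizutaniThetaRational.lean`), so some nonzero `w ⊥ Θ_{p−1}(v)` has coordinates in `L(α)`, and
  `Θ_{p−1}(w) ∋ ∇^s w ≠ 0` rational and `⊥ v` by (DUAL) — an `L`-linear relation among the coordinates of `v`;
* **`IsRootTower.finrank_thetaSpan_add_le_finrank_thetaSpan_sub_one`** (`dim Θ_j(v) + 2(p − 1 − j) ≤ dim Θ_{p−1}(v)`) and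
  `IsRootTower.three_le_finrank_thetaSpan_one`.

## References

* H. Mizutani, *Hironaka's additive group schemes*, Nagoya Math. J. 52 (1973) 85–95, proof of Thm. 2.8 (p. 90–91).
  [Mizutani1973HironakaGroupSchemes]
-/

noncomputable section

open MvPolynomial Literature.AlgebraicGeometry.Resolution

namespace Summit.ResolutionOfSingularities.KangarooAtlas.Mizutani

universe u

section StepIneq

variable {L K : Type u} [Field L] [Field K] [Algebra L K] {s p : ℕ} [hp : Fact p.Prime] [CharP K p]
  {x : Fin s → L} {a : Fin s → K} {ι : Type*}

/-- `Θ_0(v) = K · v`. [folklore] -/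
theorem IsRootTower.thetaSpan_zero_eq (h : IsRootTower L K (p ^ 1) x a) (v : ι → K) : h.thetaSpan 0 v = K ∙ v := by
  apply le_antisymm
  · unfold IsRootTower.thetaSpan
    rw [Submodule.span_le]
    rintro _ ⟨T, hT, rfl⟩
    have hT0 : T = 0 := (Finsupp.degree_eq_zero_iff T).mp (Nat.le_zero.mp (mem_degLE.mp (Finset.mem_coe.mp hT)))
    have : (fun i => h.sigD T (v i)) = v := by funext i; rw [hT0, h.sigD_zero, LinearMap.id_apply]
    change (fun i => h.sigD T (v i)) ∈ K ∙ v
    rw [this]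
    exact Submodule.mem_span_singleton_self v
  · rw [Submodule.span_le, Set.singleton_subset_iff]
    exact h.self_mem_thetaSpan 0 v

/-- `dim_K Θ_0(v) = 1` for `v ≠ 0`. [folklore] -/
theorem IsRootTower.finrank_thetaSpan_zero (h : IsRootTower L K (p ^ 1) x a) {v : ι → K} (hv : v ≠ 0) :
    Module.finrank K (h.thetaSpan 0 v) = 1 := by
  rw [h.thetaSpan_zero_eq, finrank_span_singleton hv]

variable [Fintype ι] [DecidableEq ι]

/-- **MIZUTANI'S STEP INEQUALITY** `dim_K Θ_m(v) + 2 ≤ dim_K Θ_{m+1}(v)` (`m + 2 ≤ p`) for a vector `v` with `L`-independent coordinates in a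
root tower of exponent one with `K^p ⊆ L`, given (H) no nonzero `L`-rational vector in `Θ_{p−1}(v)`, (DUAL) `w ⊥ Θ_{p−1}(v) ⇒ Θ_{p−1}(w) ⊥ v`,
and `dim Θ_{p−1}(v) < #ι`. [cite: Mizutani1973HironakaGroupSchemes, proof of Thm. 2.8 (p. 90: «We claim dim_k Diff_{i+1}(k)f ≥ dim_k Diff_i(k)f + 2 (i = 0, …, p − 2)»)] -/
theorem IsRootTower.finrank_thetaSpan_add_two_le (h : IsRootTower L K (p ^ 1) x a)
    (hKp : ∀ y : K, y ^ p ∈ (algebraMap L K).range) {v : ι → K} (hvind : LinearIndependent L v) (hv : v ≠ 0)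
    (hH : ∀ θ ∈ h.thetaSpan (p - 1) v, (∀ i, θ i ∈ (algebraMap L K).range) → θ = 0)
    (hdual : ∀ w : ι → K, (∀ θ ∈ h.thetaSpan (p - 1) v, ∑ i, w i * θ i = 0) →
      ∀ g ∈ h.thetaSpan (p - 1) w, ∑ i, g i * v i = 0)
    (hlt : Module.finrank K (h.thetaSpan (p - 1) v) < Fintype.card ι) {m : ℕ} (hm : m + 2 ≤ p) :
    Module.finrank K (h.thetaSpan m v) + 2 ≤ Module.finrank K (h.thetaSpan (m + 1) v) := by
  classical
  obtain ⟨P, g, hmem, hpiv, hrep⟩ := exists_echelon (h.thetaSpan m v)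
  rw [h.finrank_thetaSpan_succ_eq m v hmem hpiv hrep]
  suffices hN : 2 ≤ Module.finrank K (h.derivSpan P g) by omega
  by_contra hlt2
  have hle1 : Module.finrank K (h.derivSpan P g) ≤ 1 := by omega
  have hmono : ∀ {j : ℕ}, j ≤ p - 1 → ∀ {θ : ι → K}, θ ∈ h.thetaSpan j v → θ ∈ h.thetaSpan (p - 1) v :=
    fun hj _ hθ => h.thetaSpan_mono hj v hθ
  -- a vector whose coordinates are killed by every `∂_l` is `L`-rational
  have hrat : ∀ θ : ι → K, (∀ l i, h.sigD (Finsupp.single l 1) (θ i) = 0) → ∀ i, θ i ∈ (algebraMap L K).range := by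
    intro θ hθ i
    obtain ⟨c, hc⟩ := h.exists_eq_algebraMap_of_der_eq_zero le_rfl hKp (z := θ i) fun l => by rw [h.der_apply]; exact hθ l i
    exact ⟨c, hc⟩
  -- the pivots are nonempty (`v = Σ_{j ∈ P} v_j g_j ≠ 0`)
  obtain ⟨j₀, hj₀⟩ : P.Nonempty := by
    by_contra hP
    rw [Finset.not_nonempty_iff_eq_empty] at hP
    have := hrep v (h.self_mem_thetaSpan m v)
    rw [hP, Finset.sum_empty] at this
    exact hv this
  -- `dim N ≤ 1`: a generator `r₀`
  obtain ⟨r₀', hr₀'⟩ := finrank_le_one_iff.mp hle1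
  set r₀ : ι → K := (r₀' : ι → K) with hr₀def
  have hN : ∀ θ ∈ h.derivSpan P g, ∃ c : K, c • r₀ = θ := fun θ hθ => by
    obtain ⟨c, hc⟩ := hr₀' ⟨θ, hθ⟩
    exact ⟨c, by simpa [hr₀def] using congrArg Subtype.val hc⟩
  by_cases hr0 : r₀ = 0
  · -- `N = 0`: `g_{j₀}` is rational, nonzero, in `Θ_m(v) ⊆ Θ_{p−1}(v)` — contradicts (H)
    have hzero : ∀ l, ∀ j ∈ P, h.dvec l (g j) = 0 := fun l j hj => by
      obtain ⟨c, hc⟩ := hN _ (h.dvec_mem_derivSpan g l hj)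
      rw [← hc, hr0, smul_zero]
    have hg0 := hH (g j₀) (hmono (by omega) (hmem j₀ hj₀)) (hrat _ fun l i => by
      have := congrFun (hzero l j₀ hj₀) i
      rwa [h.dvec_apply] at this)
    have := hpiv j₀ hj₀ j₀ hj₀
    rw [if_pos rfl, hg0, Pi.zero_apply] at this
    exact zero_ne_one this
  · -- normalise the generator: `r u₁ = 1`
    obtain ⟨u₁, hu₁⟩ : ∃ u₁, r₀ u₁ ≠ 0 := by
      by_contra hall; push Not at hall; exact hr0 (funext hall)
    set r : ι → K := (r₀ u₁)⁻¹ • r₀ with hrdef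
    have hru₁ : r u₁ = 1 := by rw [hrdef, Pi.smul_apply, smul_eq_mul, inv_mul_cancel₀ hu₁]
    have hrN : r ∈ h.derivSpan P g := Submodule.smul_mem _ _ r₀'.2
    have hN' : ∀ θ ∈ h.derivSpan P g, ∃ c : K, c • r = θ := fun θ hθ => by
      obtain ⟨c, hc⟩ := hN θ hθ
      exact ⟨c * r₀ u₁, by rw [← hc, hrdef, smul_smul, mul_assoc, mul_inv_cancel₀ hu₁, mul_one]⟩
    -- (***) `∂_l g_j = (∂_l y_j) · r` with `y_j = g_j(u₁)`
    have hstar : ∀ l, ∀ j ∈ P, h.dvec l (g j) = h.sigD (Finsupp.single l 1) (g j u₁) • r := by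
      intro l j hj
      obtain ⟨c, hc⟩ := hN' _ (h.dvec_mem_derivSpan g l hj)
      have hcoef : h.sigD (Finsupp.single l 1) (g j u₁) = c := by
        have := congrFun hc u₁
        rw [h.dvec_apply, Pi.smul_apply, hru₁, smul_eq_mul, mul_one] at this
        exact this.symm
      rw [hcoef, hc]
    by_cases hrrat : ∀ u, r u ∈ (algebraMap L K).range
    · -- sub-case A: `r` is rational, nonzero, in `Θ_{m+1}(v) ⊆ Θ_{p−1}(v)` — contradicts (H)
      have hrΘ : r ∈ h.thetaSpan (p - 1) v := by
        have hle : h.derivSpan P g ≤ h.thetaSpan (m + 1) v := by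
          rw [h.thetaSpan_succ_eq_sup_derivSpan m v hmem hrep]; exact le_sup_right
        exact hmono (by omega) (hle hrN)
      have := hH r hrΘ hrrat
      rw [this, Pi.zero_apply] at hru₁
      exact zero_ne_one hru₁
    · -- sub-case B: a non-rational coordinate `α = r(u⋆)`; all coordinates lie in `E = L(α)`
      push Not at hrrat
      obtain ⟨ustar, hustar⟩ := hrrat
      obtain ⟨l₀, hl₀⟩ : ∃ l₀, h.der le_rfl l₀ (r ustar) ≠ 0 := by
        by_contra hall; push Not at hall
        obtain ⟨c, hc⟩ := h.exists_eq_algebraMap_of_der_eq_zero le_rfl hKp hall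
        exact hustar ⟨c, hc⟩
      set α : K := r ustar with hαdef
      set E : IntermediateField L K := IntermediateField.adjoin L {α} with hEdef
      -- (**) symmetry of mixed derivatives: `∂_l y_j · ∂_{l'} r_u = ∂_{l'} y_j · ∂_l r_u`
      have hsymm : ∀ (l l' : Fin s), ∀ j ∈ P, ∀ u,
          h.der le_rfl l (g j u₁) * h.der le_rfl l' (r u) = h.der le_rfl l' (g j u₁) * h.der le_rfl l (r u) := by
        intro l l' j hj u
        have hcomm : h.sigD (Finsupp.single l' 1) (h.dvec l (g j) u) = h.sigD (Finsupp.single l 1) (h.dvec l' (g j) u) := by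
          rw [h.dvec_apply, h.dvec_apply, h.sigD_comm]
        have e1 : h.sigD (Finsupp.single l' 1) (h.dvec l (g j) u) =
            h.sigD (Finsupp.single l' 1) (h.sigD (Finsupp.single l 1) (g j u₁)) * r u +
              h.sigD (Finsupp.single l 1) (g j u₁) * h.sigD (Finsupp.single l' 1) (r u) := by
          rw [hstar l j hj, Pi.smul_apply, smul_eq_mul, h.sigD_single_mul le_rfl]
        have e2 : h.sigD (Finsupp.single l 1) (h.dvec l' (g j) u) =
            h.sigD (Finsupp.single l 1) (h.sigD (Finsupp.single l' 1) (g j u₁)) * r u +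
              h.sigD (Finsupp.single l' 1) (g j u₁) * h.sigD (Finsupp.single l 1) (r u) := by
          rw [hstar l' j hj, Pi.smul_apply, smul_eq_mul, h.sigD_single_mul le_rfl]
        rw [e1, e2, h.sigD_comm (Finsupp.single l' 1) (Finsupp.single l 1)] at hcomm
        simp only [h.der_apply]
        exact add_left_cancel hcomm
      -- B1: the leaders `y_j ∈ E`
      have hy : ∀ j ∈ P, g j u₁ ∈ E := fun j hj =>
        h.mem_adjoin_simple_of_der_eq_mul le_rfl hKp (κ := (h.der le_rfl l₀ α)⁻¹ * h.der le_rfl l₀ (g j u₁)) fun l => by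
          have e := hsymm l l₀ j hj ustar
          calc h.der le_rfl l (g j u₁)
              = (h.der le_rfl l₀ α)⁻¹ * (h.der le_rfl l (g j u₁) * h.der le_rfl l₀ α) := by
                rw [mul_comm (h.der le_rfl l (g j u₁)), ← mul_assoc, inv_mul_cancel₀ hl₀, one_mul]
            _ = (h.der le_rfl l₀ α)⁻¹ * (h.der le_rfl l₀ (g j u₁) * h.der le_rfl l α) := by rw [e]
            _ = (h.der le_rfl l₀ α)⁻¹ * h.der le_rfl l₀ (g j u₁) * h.der le_rfl l α := by rw [mul_assoc]
      -- B2: all coordinates `g_j(u) ∈ E`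
      have hgE : ∀ j ∈ P, ∀ u, g j u ∈ E := fun j hj u =>
        h.mem_adjoin_simple_of_der_eq_mul le_rfl hKp
          (κ := h.nabla l₀ α (g j u₁) * r u) fun l => by
          have e := congrFun (hstar l j hj) u
          rw [h.dvec_apply, Pi.smul_apply, smul_eq_mul] at e
          rw [h.der_apply, e, ← h.der_apply le_rfl l (g j u₁), h.der_eq_mul_nabla hl₀ (hy j hj) l]
          ring
      -- B3: some leader has `∂_{l₀} y_{j₁} ≠ 0` (else `N = 0`)
      obtain ⟨j₁, hj₁, hj₁ne⟩ : ∃ j₁ ∈ P, h.der le_rfl l₀ (g j₁ u₁) ≠ 0 := by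
        by_contra hall
        push Not at hall
        have hdv : ∀ l, ∀ j ∈ P, h.dvec l (g j) = 0 := fun l j hj => by
          rw [hstar l j hj, ← h.der_apply le_rfl l, h.der_eq_mul_nabla hl₀ (hy j hj) l, h.nabla_apply, hall j hj, mul_zero,
            mul_zero, zero_smul]
        have hNbot : h.derivSpan P g = ⊥ := by
          unfold IsRootTower.derivSpan
          rw [Submodule.span_eq_bot]
          rintro _ ⟨l, j, hj, rfl⟩
          exact hdv l j hj
        have : r = 0 := by have := hrN; rwa [hNbot, Submodule.mem_bot] at this
        rw [this, Pi.zero_apply] at hru₁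
        exact zero_ne_one hru₁
      -- B4: the coordinates of `r` lie in `E`
      have hrE : ∀ u, r u ∈ E := fun u =>
        h.mem_adjoin_simple_of_der_eq_mul le_rfl hKp
          (κ := (h.der le_rfl l₀ (g j₁ u₁))⁻¹ * h.der le_rfl l₀ (r u) * h.nabla l₀ α (g j₁ u₁)) fun l' => by
          have e := hsymm l₀ l' j₁ hj₁ u
          have e' := h.der_eq_mul_nabla hl₀ (hy j₁ hj₁) l'
          calc h.der le_rfl l' (r u)
              = (h.der le_rfl l₀ (g j₁ u₁))⁻¹ * (h.der le_rfl l₀ (g j₁ u₁) * h.der le_rfl l' (r u)) := by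
                rw [← mul_assoc, inv_mul_cancel₀ hj₁ne, one_mul]
            _ = (h.der le_rfl l₀ (g j₁ u₁))⁻¹ * (h.der le_rfl l' (g j₁ u₁) * h.der le_rfl l₀ (r u)) := by rw [e]
            _ = (h.der le_rfl l₀ (g j₁ u₁))⁻¹ * h.der le_rfl l₀ (r u) * h.nabla l₀ α (g j₁ u₁) * h.der le_rfl l' α := by
                rw [e']; ring
      -- `Θ_{m+1}(v) = span (g(P) ∪ {r})` is spanned by `E`-vectors
      have hΘsucc : h.thetaSpan (m + 1) v = Submodule.span K (g '' (P : Set ι) ∪ {r}) := by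
        rw [h.thetaSpan_succ_eq_sup_derivSpan m v hmem hrep, Submodule.span_union]
        congr 1
        · apply le_antisymm
          · intro θ hθ
            rw [hrep θ hθ]
            exact Submodule.sum_mem _ fun j hj =>
              Submodule.smul_mem _ _ (Submodule.subset_span ⟨j, Finset.mem_coe.mpr hj, rfl⟩)
          · rw [Submodule.span_le]
            rintro _ ⟨j, hj, rfl⟩
            exact hmem j (Finset.mem_coe.mp hj)
        · apply le_antisymm
          · intro θ hθ
            obtain ⟨c, hc⟩ := hN' θ hθ
            rw [Submodule.mem_span_singleton]
            exact ⟨c, hc⟩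
          · rw [Submodule.span_le, Set.singleton_subset_iff]
            exact hrN
      have hGE : ∀ g' ∈ g '' (P : Set ι) ∪ {r}, ∀ i, g' i ∈ IntermediateField.adjoin L {α} := by
        rintro g' (⟨j, hj, rfl⟩ | hg') i
        · exact hgE j (Finset.mem_coe.mp hj) i
        · rw [Set.mem_singleton_iff.mp hg']; exact hrE i
      -- propagate to `Θ_{p−1}(v)`
      obtain ⟨G, hG, hΘG⟩ := h.exists_rational_span_thetaSpan_of_le hl₀ hGE hΘsucc (j := p - 1) (by omega)
      -- an orthogonal vector, normalised, then made `E`-rational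
      obtain ⟨w₀, hw₀ne, hw₀perp⟩ := exists_perp_of_finrank_lt (h.thetaSpan (p - 1) v) hlt
      obtain ⟨u₀, hu₀⟩ : ∃ u₀, w₀ u₀ ≠ 0 := by
        by_contra hall; push Not at hall; exact hw₀ne (funext hall)
      set w₁ : ι → K := (w₀ u₀)⁻¹ • w₀ with hw₁def
      have hw₁u₀ : w₁ u₀ = 1 := by rw [hw₁def, Pi.smul_apply, smul_eq_mul, inv_mul_cancel₀ hu₀]
      have hw₁perp : ∀ θ ∈ h.thetaSpan (p - 1) v, ∑ i, w₁ i * θ i = 0 := fun θ hθ => by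
        have : ∑ i, w₁ i * θ i = (w₀ u₀)⁻¹ * ∑ i, w₀ i * θ i := by
          rw [Finset.mul_sum]
          exact Finset.sum_congr rfl fun i _ => by rw [hw₁def, Pi.smul_apply, smul_eq_mul, mul_assoc]
        rw [this, hw₀perp θ hθ, mul_zero]
      set GE : Set (ι → E) := {g' | (fun i => (g' i : K)) ∈ G} with hGEdef
      obtain ⟨w, hwu₀, hwperp⟩ := exists_rational_perp E (G := GE) hw₁u₀ fun g' hg' =>
        hw₁perp _ (by rw [hΘG]; exact Submodule.subset_span hg')
      set wK : ι → K := fun i => (w i : K) with hwKdef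
      have hwKE : ∀ i, wK i ∈ IntermediateField.adjoin L {α} := fun i => (w i).2
      have hwK0 : wK ≠ 0 := fun h0 => by
        have := congrFun h0 u₀
        rw [hwKdef, Pi.zero_apply] at this
        simp only [hwu₀] at this
        exact one_ne_zero (by exact_mod_cast this)
      have hwKperp : ∀ θ ∈ h.thetaSpan (p - 1) v, ∑ i, wK i * θ i = 0 := by
        set φ : (ι → K) →ₗ[K] K := Fintype.linearCombination K wK with hφ
        have hφapply : ∀ θ : ι → K, φ θ = ∑ i, wK i * θ i := fun θ => by
          rw [hφ, Fintype.linearCombination_apply]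
          exact Finset.sum_congr rfl fun i _ => by rw [smul_eq_mul, mul_comm]
        have hle : h.thetaSpan (p - 1) v ≤ LinearMap.ker φ := by
          rw [hΘG, Submodule.span_le]
          intro g' hg'
          rw [SetLike.mem_coe, LinearMap.mem_ker, hφapply]
          set gE : ι → E := fun i => ⟨g' i, hG g' hg' i⟩ with hgE
          have hgmem : gE ∈ GE := by
            show (fun i => ((gE i : E) : K)) ∈ G
            exact hg'
          have := congrArg (algebraMap E K) (hwperp gE hgmem)
          rw [map_sum, map_zero] at this
          rw [← this]
          exact Finset.sum_congr rfl fun i _ => by rw [map_mul]; rfl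
        intro θ hθ
        have := hle hθ
        rwa [LinearMap.mem_ker, hφapply] at this
      -- (DUAL): `Θ_{p−1}(wK) ⊥ v`; the rational vector `λ ∈ Θ_{p−1}(wK)` gives an `L`-relation among the `v_i`
      obtain ⟨lam, hlam, hlam0, hlamrat⟩ := h.exists_rational_mem_thetaSpan hKp hl₀ hwKE hwK0
      have hsum := hdual wK hwKperp lam hlam
      choose c hc using fun i => RingHom.mem_range.mp (hlamrat i)
      have hrel : ∑ i, c i • v i = 0 := by
        rw [← hsum]
        exact Finset.sum_congr rfl fun i _ => by rw [Algebra.smul_def, hc i]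
      have hc0 := Fintype.linearIndependent_iff.mp hvind c hrel
      apply hlam0
      funext i
      rw [← hc i, hc0 i, map_zero, Pi.zero_apply]

/-- **`dim_K Θ_j(v) + 2(p − 1 − j) ≤ dim_K Θ_{p−1}(v)`** (`j ≤ p − 1`): the step inequality summed. [cite: Mizutani1973HironakaGroupSchemes, proof of Thm. 2.8, Step (I) («the sequence of the dimensions … is necessarily 1, 3, 5, …, 2p − 1»)] -/
theorem IsRootTower.finrank_thetaSpan_add_le_finrank_thetaSpan_sub_one (h : IsRootTower L K (p ^ 1) x a)
    (hKp : ∀ y : K, y ^ p ∈ (algebraMap L K).range) {v : ι → K} (hvind : LinearIndependent L v) (hv : v ≠ 0)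
    (hH : ∀ θ ∈ h.thetaSpan (p - 1) v, (∀ i, θ i ∈ (algebraMap L K).range) → θ = 0)
    (hdual : ∀ w : ι → K, (∀ θ ∈ h.thetaSpan (p - 1) v, ∑ i, w i * θ i = 0) →
      ∀ g ∈ h.thetaSpan (p - 1) w, ∑ i, g i * v i = 0)
    (hlt : Module.finrank K (h.thetaSpan (p - 1) v) < Fintype.card ι) {j : ℕ} (hj : j ≤ p - 1) :
    Module.finrank K (h.thetaSpan j v) + 2 * (p - 1 - j) ≤ Module.finrank K (h.thetaSpan (p - 1) v) := by
  -- induction on `d = p − 1 − j`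
  suffices key : ∀ d : ℕ, ∀ j : ℕ, j + d = p - 1 →
      Module.finrank K (h.thetaSpan j v) + 2 * d ≤ Module.finrank K (h.thetaSpan (p - 1) v) by
    have := key (p - 1 - j) j (by omega)
    rwa [show p - 1 - j = p - 1 - j from rfl] at this
  intro d
  induction d with
  | zero => intro j hj; rw [mul_zero, add_zero, show j = p - 1 by omega]
  | succ d ih =>
    intro j hj
    have hstep := h.finrank_thetaSpan_add_two_le hKp hvind hv hH hdual hlt (m := j) (by omega)
    have := ih (j + 1) (by omega)
    omega

/-- **`3 ≤ dim_K Θ_1(v)`** (the first step, `p ≥ 2`). [cite: Mizutani1973HironakaGroupSchemes, proof of Thm. 2.8 (dim Diff_1(k) f ≥ 3)] -/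
theorem IsRootTower.three_le_finrank_thetaSpan_one (h : IsRootTower L K (p ^ 1) x a)
    (hKp : ∀ y : K, y ^ p ∈ (algebraMap L K).range) {v : ι → K} (hvind : LinearIndependent L v) (hv : v ≠ 0)
    (hH : ∀ θ ∈ h.thetaSpan (p - 1) v, (∀ i, θ i ∈ (algebraMap L K).range) → θ = 0)
    (hdual : ∀ w : ι → K, (∀ θ ∈ h.thetaSpan (p - 1) v, ∑ i, w i * θ i = 0) →
      ∀ g ∈ h.thetaSpan (p - 1) w, ∑ i, g i * v i = 0)
    (hlt : Module.finrank K (h.thetaSpan (p - 1) v) < Fintype.card ι) :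
    3 ≤ Module.finrank K (h.thetaSpan 1 v) := by
  have hstep := h.finrank_thetaSpan_add_two_le hKp hvind hv hH hdual hlt (m := 0) (by have := hp.out.two_le; omega)
  rw [h.finrank_thetaSpan_zero hv] at hstep
  exact hstep

/-- **`2j + 1 ≤ dim_K Θ_j(v)`** (`j ≤ p − 1`): the step inequality summed from `Θ_0(v) = K·v`. [cite: Mizutani1973HironakaGroupSchemes, proof of Thm. 2.8 («1, 3, 5, …, 2p − 1»)] -/
theorem IsRootTower.two_mul_add_one_le_finrank_thetaSpan (h : IsRootTower L K (p ^ 1) x a)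
    (hKp : ∀ y : K, y ^ p ∈ (algebraMap L K).range) {v : ι → K} (hvind : LinearIndependent L v) (hv : v ≠ 0)
    (hH : ∀ θ ∈ h.thetaSpan (p - 1) v, (∀ i, θ i ∈ (algebraMap L K).range) → θ = 0)
    (hdual : ∀ w : ι → K, (∀ θ ∈ h.thetaSpan (p - 1) v, ∑ i, w i * θ i = 0) →
      ∀ g ∈ h.thetaSpan (p - 1) w, ∑ i, g i * v i = 0)
    (hlt : Module.finrank K (h.thetaSpan (p - 1) v) < Fintype.card ι) {j : ℕ} (hj : j ≤ p - 1) :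
    2 * j + 1 ≤ Module.finrank K (h.thetaSpan j v) := by
  induction j with
  | zero => rw [h.finrank_thetaSpan_zero hv]
  | succ j ih =>
    have hstep := h.finrank_thetaSpan_add_two_le hKp hvind hv hH hdual hlt (m := j) (by omega)
    have := ih (by omega)
    omega

/-- **THE PROFILE IS `1, 3, 5, …, 2p − 1`**: if moreover `dim_K Θ_{p−1}(v) = 2p − 1`, then `dim_K Θ_j(v) = 2j + 1` for all `j ≤ p − 1`
(Mizutani, Step (I): «the sequence of the dimensions of `k·f ⊂ Diff_1(k)f ⊂ ⋯ ⊂ Diff_{p−1}(k)f` is necessarily `1, 3, 5, …, 2p − 1`. In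
particular `dim Diff_1(k)f = 3` and `dim Diff_2(k)f = 5`»). [cite: Mizutani1973HironakaGroupSchemes, proof of Thm. 2.8, Step (I) (p. 91)] -/
theorem IsRootTower.finrank_thetaSpan_eq_of_eq (h : IsRootTower L K (p ^ 1) x a)
    (hKp : ∀ y : K, y ^ p ∈ (algebraMap L K).range) {v : ι → K} (hvind : LinearIndependent L v) (hv : v ≠ 0)
    (hH : ∀ θ ∈ h.thetaSpan (p - 1) v, (∀ i, θ i ∈ (algebraMap L K).range) → θ = 0)
    (hdual : ∀ w : ι → K, (∀ θ ∈ h.thetaSpan (p - 1) v, ∑ i, w i * θ i = 0) →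
      ∀ g ∈ h.thetaSpan (p - 1) w, ∑ i, g i * v i = 0)
    (hlt : Module.finrank K (h.thetaSpan (p - 1) v) < Fintype.card ι)
    (htop : Module.finrank K (h.thetaSpan (p - 1) v) = 2 * p - 1) {j : ℕ} (hj : j ≤ p - 1) :
    Module.finrank K (h.thetaSpan j v) = 2 * j + 1 := by
  have h1 := h.two_mul_add_one_le_finrank_thetaSpan hKp hvind hv hH hdual hlt hj
  have h2 := h.finrank_thetaSpan_add_le_finrank_thetaSpan_sub_one hKp hvind hv hH hdual hlt hj
  have := hp.out.two_le
  omega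

end StepIneq

end Summit.ResolutionOfSingularities.KangarooAtlas.Mizutani

end
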